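import Summits.HodgeConjecture.HodgeCM.PerL34.RealApproximation_1

/-! PORT of `HodgeCM/PerL34/RealApproximation.lean` (HodgeCMPerL run 82) — part 2: continuation of `Summits.HodgeConjecture.HodgeCM.PerL34.RealApproximation_1` (split at a top-level declaration boundary by port_pkg.py; scope re-opened below; declarations unchanged). -/

-- port_pkg: scope re-opened for this part (file-level context, then the namespace/section stack open at the cut)
set_option autoImplicit false
noncomputable section
open Matrix Topology Filter
open scoped ComplexConjugate
namespace HodgeCM
namespace PerL34
namespace RealApproximation
variable {m n : Type*} [Fintype n] [DecidableEq n]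
section Core
variable (K : Subfield ℂ) (H : Matrix n n ℂ)
variable {K H}
/-- For any `G`, only finitely many scalars `w` have `det (1 + w G) = 0`. -/
theorem finite_det_one_add_smul_eq_zero (G : Matrix n n ℂ) : {w : ℂ | (1 + w • G).det = 0}.Finite := by
  classical
  -- the polynomial `P(w) = det (1 + w G)`
  let M : Matrix n n (Polynomial ℂ) :=
    Matrix.of fun i j => Polynomial.C ((1 : Matrix n n ℂ) i j) + Polynomial.X * Polynomial.C (G i j)
  have hev : ∀ w : ℂ, (Polynomial.evalRingHom w).mapMatrix M = 1 + w • G := by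
    intro w
    ext i j
    simp only [RingHom.mapMatrix_apply, Matrix.map_apply, M, Matrix.of_apply, Polynomial.coe_evalRingHom,
      Polynomial.eval_add, Polynomial.eval_C, Polynomial.eval_mul, Polynomial.eval_X, Matrix.add_apply,
      Matrix.smul_apply, smul_eq_mul]
  have hP : ∀ w : ℂ, (M.det).eval w = (1 + w • G).det := by
    intro w
    rw [← Polynomial.coe_evalRingHom, RingHom.map_det, hev]
  have hP0 : M.det ≠ 0 := by
    intro h0
    have := hP 0
    rw [h0, Polynomial.eval_zero, zero_smul, add_zero, det_one] at this
    exact zero_ne_one this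
  have hfin := Polynomial.finite_setOf_isRoot hP0
  refine hfin.subset ?_
  intro w hw
  simp only [Set.mem_setOf_eq] at hw ⊢
  rw [Polynomial.IsRoot.def, hP, hw]

/-- The rational parametrisation `t ↦ (1 + it)/(1 - it)` of the unit circle minus `{-1}`. -/
def circ (t : ℝ) : ℂ := (1 + t * Complex.I) / (1 - t * Complex.I)

/-- (Ported verbatim from the HodgeCMPerL package; no docstring in the source.) -/
theorem one_sub_ne_zero (t : ℝ) : (1 : ℂ) - t * Complex.I ≠ 0 := by
  intro h
  have := congrArg Complex.re h
  simp at this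

/-- (Ported verbatim from the HodgeCMPerL package; no docstring in the source.) -/
theorem one_add_ne_zero (t : ℝ) : (1 : ℂ) + t * Complex.I ≠ 0 := by
  intro h
  have := congrArg Complex.re h
  simp at this

/-- (Ported verbatim from the HodgeCMPerL package; no docstring in the source.) -/
theorem conj_circ (t : ℝ) : conj (circ t) = (1 - t * Complex.I) / (1 + t * Complex.I) := by
  simp only [circ, map_div₀, map_add, map_sub, map_one, map_mul, Complex.conj_ofReal, Complex.conj_I]
  ring

/-- (Ported verbatim from the HodgeCMPerL package; no docstring in the source.) -/
theorem conj_circ_mul_circ (t : ℝ) : conj (circ t) * circ t = 1 := by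
  rw [conj_circ, circ, div_mul_div_comm, mul_comm (1 + (t : ℂ) * Complex.I)]
  exact div_self (mul_ne_zero (one_sub_ne_zero t) (one_add_ne_zero t))

/-- (Ported verbatim from the HodgeCMPerL package; no docstring in the source.) -/
theorem circ_mul_conj_circ (t : ℝ) : circ t * conj (circ t) = 1 := by
  rw [mul_comm, conj_circ_mul_circ]

/-- (Ported verbatim from the HodgeCMPerL package; no docstring in the source.) -/
theorem one_add_circ (t : ℝ) : 1 + circ t = 2 / (1 - t * Complex.I) := by
  rw [circ, one_add_div (one_sub_ne_zero t)]
  ring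

/-- `circ t` is never `-1` (the point at `t = ∞`). -/
theorem one_add_circ_ne_zero (t : ℝ) : 1 + circ t ≠ 0 := by
  rw [one_add_circ]
  exact div_ne_zero two_ne_zero (one_sub_ne_zero t)

/-- (Ported verbatim from the HodgeCMPerL package; no docstring in the source.) -/
theorem circ_injective : Function.Injective circ := by
  intro s t h
  rw [circ, circ, div_eq_div_iff (one_sub_ne_zero s) (one_sub_ne_zero t)] at h
  have := congrArg Complex.im h
  simp at this
  linarith

/-- **Step 3 / main theorem (matrix form).**  For a dense, conjugation-stable subfield `K ⊆ ℂ` and a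
hermitian `K`-matrix `H` with `det H ≠ 0`, every `G ∈ U(H)` is a limit of elements of `U(H)(K)`. -/
theorem closure_kUnitary (hK : ∀ z ∈ K, conj z ∈ K) (hKd : Dense (K : Set ℂ)) (hHK : IsKMat K H)
    (hH : Hᴴ = H) (hHd : H.det ≠ 0) {G : Matrix n n ℂ} (hG : Gᴴ * H * G = H) :
    G ∈ closure (kUnitary K H : Set (Matrix n n ℂ)) := by
  have hHu : IsUnit H.det := isUnit_iff_ne_zero.mpr hHd
  -- choose a good unit scalar
  have hbad : {t : ℝ | conj (circ t) ∈ {w : ℂ | (1 + w • G).det = 0}}.Finite := by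
    refine Set.Finite.preimage (Set.injOn_of_injective ?_) (finite_det_one_add_smul_eq_zero G)
    exact (RingHom.injective _).comp circ_injective
  obtain ⟨t, -, ht⟩ := Set.infinite_univ.exists_notMem_finite hbad
  simp only [Set.mem_setOf_eq] at ht
  set ζ : ℂ := circ t with hζ
  -- the two factors
  have hA : (ζ • (1 : Matrix n n ℂ)) ∈ closure (kUnitary K H : Set (Matrix n n ℂ)) := by
    refine mem_closure_kUnitary_of_det_ne_zero hK hKd hHK hH hHu (smul_unitary (by simp) ?_) ?_
    · rw [hζ, conj_circ_mul_circ]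
    · rw [show (1 : Matrix n n ℂ) + ζ • (1 : Matrix n n ℂ) = (1 + ζ) • (1 : Matrix n n ℂ) by
        rw [add_smul, one_smul], det_smul, det_one, mul_one]
      exact pow_ne_zero _ (one_add_circ_ne_zero t)
  have hB : (conj ζ • G) ∈ closure (kUnitary K H : Set (Matrix n n ℂ)) := by
    refine mem_closure_kUnitary_of_det_ne_zero hK hKd hHK hH hHu (smul_unitary hG ?_) ht
    rw [Complex.conj_conj, hζ, circ_mul_conj_circ]
  have hAB : ζ • (1 : Matrix n n ℂ) * (conj ζ • G) = G := by
    rw [smul_mul_assoc, Matrix.one_mul, smul_smul, hζ, circ_mul_conj_circ, one_smul]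
  rw [← hAB]
  exact (kUnitary K H).topologicalClosure.mul_mem hA hB

/-- `U(H)(K)` is dense in `U(H)` (subspace topology of `Mₙ(ℂ)`). -/
theorem dense_kUnitary_subtype (hK : ∀ z ∈ K, conj z ∈ K) (hKd : Dense (K : Set ℂ)) (hHK : IsKMat K H)
    (hH : Hᴴ = H) (hHd : H.det ≠ 0) :
    Dense {G : ({G : Matrix n n ℂ | Gᴴ * H * G = H} : Set (Matrix n n ℂ)) | IsKMat K (G : Matrix n n ℂ)} := by
  rw [IsInducing.subtypeVal.dense_iff]
  rintro ⟨G, hG⟩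
  refine closure_mono ?_ (closure_kUnitary hK hKd hHK hH hHd hG)
  rintro Y ⟨hYK, hY⟩
  exact ⟨⟨Y, hY⟩, hYK, rfl⟩

end Core

/-! ## Transfer to `GL n ℂ` and to conjugate forms -/

/-- Matrix inversion is continuous on the invertible matrices over `ℂ`. -/
theorem continuousOn_inv : ContinuousOn (Inv.inv : Matrix n n ℂ → Matrix n n ℂ) {A | IsUnit A} := by
  intro A hA
  have hd : A.det ≠ 0 := ((isUnit_iff_isUnit_det A).mp hA).ne_zero
  refine (continuousAt_matrix_inv A ?_).continuousWithinAt
  rw [Ring.inverse_eq_inv']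
  exact continuousAt_inv₀ hd

/-- The coercion `GL n ℂ → Mₙ(ℂ)` is a topological embedding (Mathlib topologises units through
`M × Mᵐᵒᵖ`; over `ℂ` inversion is continuous on `GLₙ`, so this is the subspace topology). -/
theorem isEmbedding_coe_GL : IsEmbedding (Units.val : GL n ℂ → Matrix n n ℂ) :=
  Units.isEmbedding_val_mk' continuousOn_inv fun u => (Matrix.coe_units_inv u).symm

/-! ### Transport of structure along a frame `Tᴴ H T = J` -/

section Transport

variable {H J Tm Ti : Matrix n n ℂ}

/-- If `Tᴴ H T = J` and `T T⁻¹ = 1` then `H = T⁻ᴴ J T⁻¹`. -/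
theorem form_transport (hT : Tmᴴ * H * Tm = J) (hTTi : Tm * Ti = 1) : H = Tiᴴ * J * Ti := by
  rw [← hT]
  simp only [Matrix.mul_assoc]
  rw [hTTi, Matrix.mul_one, ← Matrix.mul_assoc, ← conjTranspose_mul, hTTi, conjTranspose_one, Matrix.one_mul]

/-- Conjugation `u ↦ T u T⁻¹` carries `U(J)` into `U(H)` ("the `H`-avatar of `u`"). -/
theorem avatar_unitary (hT : Tmᴴ * H * Tm = J) (hTTi : Tm * Ti = 1) (hTiT : Ti * Tm = 1) {u : Matrix n n ℂ}
    (huJ : uᴴ * J * u = J) : (Tm * u * Ti)ᴴ * H * (Tm * u * Ti) = H := by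
  rw [form_transport hT hTTi]
  simp only [conjTranspose_mul, Matrix.mul_assoc]
  rw [← Matrix.mul_assoc Ti Tm, hTiT, Matrix.one_mul, ← Matrix.mul_assoc Tmᴴ Tiᴴ, ← conjTranspose_mul,
    hTiT, conjTranspose_one, Matrix.one_mul, ← Matrix.mul_assoc _ J, ← Matrix.mul_assoc (_ * J), huJ]

/-- Conjugation `Y ↦ T⁻¹ Y T` carries `U(H)` into `U(J)`. -/
theorem coavatar_unitary (hT : Tmᴴ * H * Tm = J) (hTTi : Tm * Ti = 1) {Y : Matrix n n ℂ}
    (hY : Yᴴ * H * Y = H) : (Ti * Y * Tm)ᴴ * J * (Ti * Y * Tm) = J := by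
  have hHJ := form_transport hT hTTi
  simp only [conjTranspose_mul, Matrix.mul_assoc]
  rw [← Matrix.mul_assoc Tiᴴ J, ← Matrix.mul_assoc (Tiᴴ * J) Ti, ← hHJ, ← Matrix.mul_assoc Yᴴ,
    ← Matrix.mul_assoc (Yᴴ * H), hY, ← Matrix.mul_assoc, hT]

/-- (Ported verbatim from the HodgeCMPerL package; no docstring in the source.) -/
theorem avatar_coavatar (hTTi : Tm * Ti = 1) (Y : Matrix n n ℂ) : Tm * (Ti * Y * Tm) * Ti = Y := by
  simp only [Matrix.mul_assoc]
  rw [hTTi, Matrix.mul_one, ← Matrix.mul_assoc, hTTi, Matrix.one_mul]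

/-- (Ported verbatim from the HodgeCMPerL package; no docstring in the source.) -/
theorem coavatar_avatar (hTiT : Ti * Tm = 1) (u : Matrix n n ℂ) : Ti * (Tm * u * Ti) * Tm = u := by
  simp only [Matrix.mul_assoc]
  rw [hTiT, Matrix.mul_one, ← Matrix.mul_assoc, hTiT, Matrix.one_mul]

/-- A frame forces `det H ≠ 0` as soon as `det J ≠ 0`. -/
theorem det_ne_zero_of_frame (hT : Tmᴴ * H * Tm = J) (hJ : J.det ≠ 0) : H.det ≠ 0 := by
  intro h0
  apply hJ
  rw [← hT, det_mul, det_mul, h0, mul_zero, zero_mul]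

/-- ... and `det J ≠ 0` as soon as `det H ≠ 0` and `T` is invertible. -/
theorem det_ne_zero_of_frame' (hT : Tmᴴ * H * Tm = J) (hTTi : Tm * Ti = 1) (hHd : H.det ≠ 0) : J.det ≠ 0 := by
  have hTd : Tm.det ≠ 0 := Matrix.det_ne_zero_of_right_inverse hTTi
  rw [← hT, det_mul, det_mul, det_conjTranspose]
  exact mul_ne_zero (mul_ne_zero (star_ne_zero.mpr hTd) hHd) hTd

/-- An element of `U(J)` has non-zero determinant if `det J ≠ 0`. -/
theorem det_ne_zero_of_unitary (hJ : J.det ≠ 0) {u : Matrix n n ℂ} (hu : uᴴ * J * u = J) : u.det ≠ 0 := by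
  intro h0
  apply hJ
  rw [← hu, det_mul, det_mul, h0, mul_zero]

end Transport

variable (K : Subfield ℂ)

/-- **Main theorem (group form).**  Let `S ≤ GL n ℂ` be the subgroup cut out by `gᴴ J g = J`, and let
`T ∈ GL n ℂ` carry the hermitian `K`-matrix `H` (`det H ≠ 0`) to `J`: `Tᴴ H T = J`.  Then the elements `u ∈ S`
whose `H`-avatar `T u T⁻¹` is `K`-rational — i.e. the image of `U(H)(K)` under `G ↦ T⁻¹ G T` — are dense in `S`
(for the topology of `GL n ℂ`).  For `K = ι₁(L)`, `H = Hm^{ι₁}`, `J = diag(1,1,-1)` this is PerL's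
"`Δ = image of G_U(L₀)` is dense in `U(2,1)`" (ll. 672–677); see `RealApproximationBall.lean`. -/
theorem dense_kPoints (hK : ∀ z ∈ K, conj z ∈ K) (hKd : Dense (K : Set ℂ)) {H : Matrix n n ℂ}
    (hHK : IsKMat K H) (hH : Hᴴ = H) (hHd : H.det ≠ 0) (T : GL n ℂ) (J : Matrix n n ℂ)
    (hT : (T : Matrix n n ℂ)ᴴ * H * (T : Matrix n n ℂ) = J) (S : Subgroup (GL n ℂ))
    (hS : ∀ g : GL n ℂ, g ∈ S ↔ (g : Matrix n n ℂ)ᴴ * J * (g : Matrix n n ℂ) = J) :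
    Dense {u : S | IsKMat K ((T : Matrix n n ℂ) * ((u : GL n ℂ) : Matrix n n ℂ) * ((T⁻¹ : GL n ℂ) : Matrix n n ℂ))} := by
  have hind : IsInducing (fun u : S => (((u : GL n ℂ)) : Matrix n n ℂ)) :=
    isEmbedding_coe_GL.isInducing.comp IsEmbedding.subtypeVal.isInducing
  rw [hind.dense_iff]
  rintro ⟨u, hu⟩
  have huJ : ((u : GL n ℂ) : Matrix n n ℂ)ᴴ * J * ((u : GL n ℂ) : Matrix n n ℂ) = J := (hS u).mp hu
  set Tm : Matrix n n ℂ := (T : Matrix n n ℂ) with hTm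
  set Ti : Matrix n n ℂ := ((T⁻¹ : GL n ℂ) : Matrix n n ℂ) with hTi
  have hTTi : Tm * Ti = 1 := by rw [hTm, hTi, ← Units.val_mul, mul_inv_cancel, Units.val_one]
  have hTiT : Ti * Tm = 1 := by rw [hTm, hTi, ← Units.val_mul, inv_mul_cancel, Units.val_one]
  -- the H-avatar `G = T u T⁻¹` of `u` is in `U(H)`, hence in the closure of `U(H)(K)`
  have hcl := closure_kUnitary hK hKd hHK hH hHd (avatar_unitary hT hTTi hTiT huJ)
  -- pull back along the continuous map `Y ↦ T⁻¹ Y T`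
  let ψ : Matrix n n ℂ → Matrix n n ℂ := fun Y => Ti * Y * Tm
  have hψc : Continuous ψ := (continuous_const.matrix_mul continuous_id).matrix_mul continuous_const
  have himg := hψc.continuousWithinAt.mem_closure_image hcl
  rw [show ψ (Tm * (u : Matrix n n ℂ) * Ti) = (u : Matrix n n ℂ) from coavatar_avatar hTiT _] at himg
  refine closure_mono ?_ himg
  rintro _ ⟨Y, ⟨hYK, hY⟩, rfl⟩
  -- `ψ Y` preserves `J`, has non-zero determinant, and its `H`-avatar is `Y`
  have hψY : (ψ Y)ᴴ * J * ψ Y = J := coavatar_unitary hT hTTi hY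
  have hdet : (ψ Y).det ≠ 0 := det_ne_zero_of_unitary (det_ne_zero_of_frame' hT hTTi hHd) hψY
  let g : GL n ℂ := Matrix.GeneralLinearGroup.mkOfDetNeZero (ψ Y) hdet
  have hg : (g : Matrix n n ℂ) = ψ Y := rfl
  have hgS : g ∈ S := (hS g).mpr (by rw [hg]; exact hψY)
  refine ⟨⟨g, hgS⟩, ?_, hg⟩
  show IsKMat K (Tm * (ψ Y) * Ti)
  rw [show Tm * ψ Y * Ti = Y from avatar_coavatar hTTi Y]
  exact hYK

/-- Special case `T = 1`, `J = H`: the `K`-points of `S = U(H) ≤ GL n ℂ` are dense in `S`. -/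
theorem dense_kPoints_self (hK : ∀ z ∈ K, conj z ∈ K) (hKd : Dense (K : Set ℂ)) {H : Matrix n n ℂ}
    (hHK : IsKMat K H) (hH : Hᴴ = H) (hHd : H.det ≠ 0) (S : Subgroup (GL n ℂ))
    (hS : ∀ g : GL n ℂ, g ∈ S ↔ (g : Matrix n n ℂ)ᴴ * H * (g : Matrix n n ℂ) = H) :
    Dense {u : S | IsKMat K (((u : GL n ℂ)) : Matrix n n ℂ)} := by
  have h := dense_kPoints K hK hKd hHK hH hHd 1 H (by simp) S hS
  simpa using h

end RealApproximation
end PerL34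
end HodgeCM

end

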